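import Summits.BirchSwinnertonDyer.BirchSwinnertonDyer.Theorems.AlignedTransportAtTwoMainConjectureOfRankZeroBSDAtTwoSeed
import Summits.BirchSwinnertonDyer.BirchSwinnertonDyer.Theorems.AlignedTransportAtTwoMainConjectureOfRankZeroBSDAtTwoSeedTwoTorsion
import HarnessLib

/-!
# Route `AlignedTransportAtTwo`, crux C2 `MainConjectureOfRankZeroBSDAtTwo` (stmt-BirchSwinnertonDyer-22298), line `birth`:
# C2 in 2-DESCENT CURRENCY — modulo PRINT, the crux ⟺ «for every seed-cell curve `W` and every cyclotomic `ℤ₂`-extension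
# datum, the 2-torsion subgroup of `Sel_{2^∞}(W/ℚ_∞)` is finite» (both directions; PART XVI of the att-p3 dictionary, crux half)

HONEST FRAMING (cell `bsd-f1-sign2`, WIDTH-5 attach seat `bsd-line-att-p3` g7; `--supports stmt-BirchSwinnertonDyer-22298 --as helper`;
BSD is NOT proved by any of this; the crux C2 stays OPEN — six lead generations: «blocked-on
`Rank1Residual.GreenbergMuConjectureIrreducible`», C2 ⟺ stub T mod PRINT, p583329). THEOREMS ONLY — no definition, no named
fact, no `sorry`; C2-NEUTRAL (closes nothing; it RESTATES the open stub T of line `birth`, `SeedMuZeroAtTwo`, in a currency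
with no `γ`, no dual datum and no `Λ`-module: bounded 2-descent up the cyclotomic tower). Every deep input is DISPLAYED as a
hypothesis which is a PUBLISHED named fact of the tree (`h17` Kato 17.4 (1)(2) at `2`, `hGr` Greenberg 4.1, `hper` the period
unit at `2`, `hmod` modularity, `hGZK` GZK), exactly as in the lead's `…Seed` file which this module composes with the
route-independent sibling `…SeedTwoTorsion` (§1: `Sel_{p^∞}(E/K_∞)[p]` finite ⟺ `X` torsion ∧ `μ = 0`).

* `mazurMainConjecture_two_of_bsdp_of_finite_selmer_twoTorsion` — per seed-cell curve: PRINT + `r_an = 0` + `BSD(W,2)` +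
  «`Sel_{2^∞}(W/ℚ_∞)[2]` finite for every cyclotomic datum» ⟹ `MazurMainConjecture W 2`
  (the lead's `…Seed.mazurMainConjecture_two_of_bsdp_of_mu_eq_zero` with `μ = 0` from §1 of the sibling);
* **`mainConjectureOfRankZeroBSDAtTwo_of_finite_selmer_twoTorsion`** — the crux BY NAME from PRINT + the seed-cell family
  statement «`Sel_{2^∞}(W/ℚ_∞)[2]` finite» (sufficiency);
* **`finite_selmer_twoTorsion_of_mazurMainConjecture_two`** — NECESSITY per curve: PRINT period unit + modularity + the
  crux's own analytic `μ₂ = 0` + `MazurMainConjecture W 2` ⟹ `Sel_{2^∞}(W/ℚ_∞)[2]` finite for every cyclotomic datum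
  (`MC` gives torsion; the lead's `…Seed.mu_eq_zero_of_mazurMainConjecture_two` gives `μ = 0`; then §1 of the sibling).

So the census reading of T is kernel-anchored: T(W) ⟺ TowerGapAtTwo W (cell `bsd-2adic` certificate) ⟺ #`Sel_{2^∞}(W/ℚ_∞)[2]` < ∞
(this pair of files); and C2 as filed is the ∀-W family statement of the last form, modulo PRINT.
References: R. Greenberg, LNM 1716 (1999) §1 Conj. 1.11, p. 60, Thm. 4.1; K. Kato, Astérisque 295 Thm. 17.4;
R. Greenberg, V. Vatsal, Invent. Math. 142 (2000) p. 2; A. Abbes, E. Ullmo, Compositio 103 (1996) Thm. A.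
-/

set_option linter.dupNamespace false
set_option autoImplicit false

noncomputable section

open scoped Classical

namespace Summit.BirchSwinnertonDyer.BirchSwinnertonDyer.Theorems.AlignedTransportAtTwoSeedTwoTorsion

open WeierstrassCurve Literature.NumberTheory.EllipticCurves

/-! ## The crux C2 in 2-descent currency (modulo PRINT, both directions) -/

section Crux

open CongruenceSubgroup Literature.NumberTheory.EllipticCurves.ModularForms
  Literature.NumberTheory.EllipticCurves.Greenberg1999
  Summit.BirchSwinnertonDyer.Rank1Residual.X1.MuLambda Summit.BirchSwinnertonDyer.Rank1Residual.F1Sign2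
  Summit.BirchSwinnertonDyer.BirchSwinnertonDyer.Theorems.Rank1ResidualX1Defs
  Summit.BirchSwinnertonDyer.BirchSwinnertonDyer.Theses.AlignedTransportAtTwo

variable (W : WeierstrassCurve ℚ) [W.IsElliptic] [W.IsGloballyMinimal]

/-- **The `2`-adic main conjecture on a seed-cell curve from PRINT + `BSD(W,2)` + BOUNDED 2-DESCENT UP THE TOWER.**
`W/ℚ` globally minimal, good ordinary at `2`, no rational point of order `2`, `r_an = 0`, `BSD(W, 2)`; PRINT as hypotheses —
Kato 17.4 (1)(2) at `2` for `W` (`h17`), Greenberg 4.1 (`hGr`), the period unit at `2` (`hper`), modularity (`hmod`), GZK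
(`hGZK`); and «`Sel_{2^∞}(W/ℚ_∞^κ)[2]` finite for every cyclotomic datum» (`hfin`). Then `MazurMainConjecture W 2` — the lead's
`…Seed.mazurMainConjecture_two_of_bsdp_of_mu_eq_zero` with `μ = 0` supplied by §1.
[cite: Kato2004Asterisque, Thm. 17.4 (1)(2) (p. 273)] [cite: GreenbergLNM1716, Thm. 4.1 (p. 102), §1 Conj. 1.11] -/
theorem mazurMainConjecture_two_of_bsdp_of_finite_selmer_twoTorsion
    (h17 : ∀ [NeZero (W.conductorNorm ℤ)] (f : CuspForm (Gamma0 (W.conductorNorm ℤ)) 2),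
      kato_divisibility_allPrimes W 2 (f := f))
    (hGr : Greenberg1999.thm41_charValue_rankZero_anyPrime)
    (hper : realPeriodRat_eq_unit_mul_plusPeriod_two) (hmod : nonempty_modularParametrizationData)
    (hGZK : rank_eq_analyticRank_of_analyticRank_le_one) (hord : IsOrdinaryAt W 2)
    (ht : ∀ x : ℚ, ¬ HasRationalTwoTorsionX W x) (hr : W.analyticRank = 0) (hbsd : BSDp W 2)
    (hfin : ∀ (κ : ZpExtension ℚ 2) (γ : Field.absoluteGaloisGroup ℚ), κ.IsCyclotomic →
      κ.IsTopGenerator γ → IsCyclotomicVariable 2 γ → Set.Finite {s : W.selmerInfty κ | 2 • s = 0}) :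
    MazurMainConjecture W 2 :=
  AlignedTransportAtTwoSeed.mazurMainConjecture_two_of_bsdp_of_mu_eq_zero W h17 hGr hper hmod hGZK hord ht hr hbsd
    fun κ γ hκ hγ hγ' D _ ↦ (isTorsion_and_mu_eq_zero_of_finite_pTorsion W κ hγ D (hfin κ γ hκ hγ hγ')).2

/-- **C2 BY NAME from PRINT + the seed-cell family statement «`Sel_{2^∞}(W/ℚ_∞)[2]` is finite».** PRINT: Kato 17.4 (1)(2)
at `2` for every curve (`h17`), Greenberg 4.1 (`hGr`), period unit (`hper`), modularity (`hmod`), GZK (`hGZK`); `hS`: for every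
seed-cell curve `W` (non-CM, good ordinary at `2`, no rational point of order `2`, `Δ ∉ ℚ²`, `r_an = 0`, analytic `μ₂ = 0`,
`BSD(W,2)`) and every cyclotomic datum, `Sel_{2^∞}(W/ℚ_∞)[2]` is finite. The sufficiency half of «C2 ⟺ bounded 2-descent up the
tower, mod PRINT». [cite: Kato2004Asterisque, Thm. 17.4 (1)(2) (p. 273)] [cite: GreenbergLNM1716, §1 Conj. 1.11, Thm. 4.1] -/
theorem mainConjectureOfRankZeroBSDAtTwo_of_finite_selmer_twoTorsion
    (h17 : ∀ (V : WeierstrassCurve ℚ) [V.IsElliptic] [V.IsGloballyMinimal] [NeZero (V.conductorNorm ℤ)]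
      (f : CuspForm (Gamma0 (V.conductorNorm ℤ)) 2), kato_divisibility_allPrimes V 2 (f := f))
    (hGr : Greenberg1999.thm41_charValue_rankZero_anyPrime)
    (hper : realPeriodRat_eq_unit_mul_plusPeriod_two) (hmod : nonempty_modularParametrizationData)
    (hGZK : rank_eq_analyticRank_of_analyticRank_le_one)
    (hS : ∀ (W : WeierstrassCurve ℚ) [W.IsElliptic] [W.IsGloballyMinimal], ¬ W.HasCM →
      IsOrdinaryAt W 2 → (∀ x : ℚ, ¬ HasRationalTwoTorsionX W x) → ¬ IsSquare W.Δ →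
      W.analyticRank = 0 →
      (∀ ⦃N : ℕ⦄ [NeZero N] (f : CuspForm (Gamma0 N) 2), IsNewformOf W f →
        ∀ G : IwasawaAlgebra 2, IsEvenBranchLiftAtTwo W f G → red G ≠ 0) →
      BSDp W 2 →
      ∀ (κ : ZpExtension ℚ 2) (γ : Field.absoluteGaloisGroup ℚ), κ.IsCyclotomic →
        κ.IsTopGenerator γ → IsCyclotomicVariable 2 γ → Set.Finite {s : W.selmerInfty κ | 2 • s = 0}) :
    MainConjectureOfRankZeroBSDAtTwo := by
  intro W _ _ hcm hord ht hsq hr hμan hbsd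
  exact mazurMainConjecture_two_of_bsdp_of_finite_selmer_twoTorsion W (fun f ↦ h17 W f) hGr hper hmod hGZK hord ht
    hr hbsd (hS W hcm hord ht hsq hr hμan hbsd)

/-- **NECESSITY: the main conjecture forces bounded 2-descent up the tower.** `W/ℚ` globally minimal, good ordinary at `2`,
no rational point of order `2`; PRINT period unit (`hper`) + modularity (`hmod`); the crux's analytic `μ₂ = 0` (`hμan`); and
`MazurMainConjecture W 2`. Then `Sel_{2^∞}(W/ℚ_∞^κ)[2]` is finite for every cyclotomic datum: `MC(W,2)` makes every `X`
torsion (its first conjunct) and forces `μ(X) = 0` (the lead's `…Seed.mu_eq_zero_of_mazurMainConjecture_two`); then §1.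
With `mainConjectureOfRankZeroBSDAtTwo_of_finite_selmer_twoTorsion`: modulo PRINT, C2 ⟺ the seed-cell family statement
«`Sel_{2^∞}(W/ℚ_∞)[2]` finite». [cite: GreenbergVatsal2000, p. 2 (2) and p. 4] [cite: AbbesUllmo1996, Thm. A]
[cite: GreenbergLNM1716, §1 Conj. 1.11] -/
theorem finite_selmer_twoTorsion_of_mazurMainConjecture_two (hper : realPeriodRat_eq_unit_mul_plusPeriod_two)
    (hmod : nonempty_modularParametrizationData) (hord : IsOrdinaryAt W 2)
    (ht : ∀ x : ℚ, ¬ HasRationalTwoTorsionX W x)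
    (hμan : ∀ ⦃N : ℕ⦄ [NeZero N] (f : CuspForm (Gamma0 N) 2), IsNewformOf W f →
      ∀ G : IwasawaAlgebra 2, IsEvenBranchLiftAtTwo W f G → red G ≠ 0)
    (hMC : MazurMainConjecture W 2) :
    ∀ (κ : ZpExtension ℚ 2) (γ : Field.absoluteGaloisGroup ℚ), κ.IsCyclotomic →
      κ.IsTopGenerator γ → IsCyclotomicVariable 2 γ → Set.Finite {s : W.selmerInfty κ | 2 • s = 0} := by
  intro κ γ hκ hγ hγ'
  obtain ⟨D⟩ := W.nonempty_selmerDualData_holds κ γ hγ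
  have hμ : D.mu = 0 := AlignedTransportAtTwoSeed.mu_eq_zero_of_mazurMainConjecture_two W hper hmod hord ht hμan hMC
    κ γ hκ hγ hγ' D
  -- torsion is the first conjunct of the main conjecture at the datum `(κ, γ, f, ϖ, D)`
  have hirr : Literature.NumberTheory.EllipticCurves.Rank1Residual.Irr W 2 :=
    AlignedTransportAtTwoSeed.irr_two_of_forall_not_hasRationalTwoTorsionX W ht
  haveI : NeZero (W.conductorNorm ℤ) := ⟨(W.conductorNorm_pos_holds).ne'⟩
  obtain ⟨Dm⟩ := hmod W
  have hf : IsNewformOf W Dm.f := Dm.isNewformOf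
  obtain ⟨u, hu, hΩ⟩ := hper W hord.1 hirr Dm.f hf
  have hΩpos : 0 < W.realPeriodRat := W.realPeriodRat_pos_holds
  have hu0 : u ≠ 0 := by
    rintro rfl
    rw [Rat.cast_zero, zero_mul] at hΩ
    exact hΩpos.ne' hΩ
  have hϖ : ((u⁻¹ : ℚ) : ℝ) * W.realPeriodRat = plusPeriod Dm.f := by
    rw [hΩ, Rat.cast_inv, ← mul_assoc, inv_mul_cancel₀ (by exact_mod_cast hu0), one_mul]
  have hX : D.IsTorsion := (hMC κ γ hκ hγ hγ' Dm.f hf u⁻¹ hϖ D).1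
  exact finite_pTorsion_of_isTorsion_of_mu_eq_zero W κ hγ D hX hμ

end Crux


end Summit.BirchSwinnertonDyer.BirchSwinnertonDyer.Theorems.AlignedTransportAtTwoSeedTwoTorsion

end
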